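import Literature.MathematicalPhysics.QuantumFieldTheory.Balaban1983to89.B15ExtensionHolomorphic

/-!
# `Balaban1983to89.B15ComplexifiedDatumFamily` — [Balaban1989LargeFieldI] = «[IV]», (1.74) p. 192, Prop. 1 p. 194 (last clause «𝕍_k = exp iB′V_k … B′ ∈ 𝔤ᶜ»);
# [Balaban1988Convergent] (2.11)–(2.14) pp. 256–257; [Balaban1985Variational] p. 307, Prop. 9 (190) p. 309:
# THE COMPLEXIFIED DATUM FAMILY OF THE N12 LETTERS, COMPOSED — `(p, B′) ↦ M˙(Q_k^{s*}(exp(iB′)·ext(exp(ip)V_k)))` as ONE map of `M₂(ℂ)`-valued fields that is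
# ℂ-differentiable, agrees with NODE 00's datum on real parameters, and intertwines coordinatewise conjugation with the unitary real structure `θ`

Honest framing: statement-level skeleton of published theorems with citation tags; proofs where landed; nothing here is a claim about the
Yang–Mills mass gap.  Cell `pub-ymgap`, HUMAN RULING D-0149 (width seats), seat `pub-ymgap-dag-n12-w1` (N12 = [B15]; U1a ∕ U1A-CENSUS (δ′) step 2, first half);
count-neutral; N12 NOT discharged; finite 𝕋⁴ at fixed ε; nothing continuum ∕ OS ∕ mass-gap ∕ Clay.

WHY.  The intrinsic analytic letter (J0′) of the N12∕s1 endpoints (`B15Prop1JointHolomorphyFromMinimiserFamily[OneSided]`) quantifies over the complexified chart parameters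
`z = (p, B′) ∈ (ℂ³)^{bonds} × (ℂ³)^{bonds}` of the configuration `expMul su2Chart B′ (ext (expMul su2Chart p V_k))`, whose DATUM for the (2.12) problem is
`M˙(Q_k^{s*} ·)` (`avgFamily (avOfRecord F 2 Kt) (qsstarGIter0 k ·)`).  The complex implicit-function route (this seat's `ConstrainedCriticalFamily` over `ℂ`) reads the
constraint VALUE as a holomorphic function of `z`; this module COMPOSES the landed holomorphic layers — `expMulC` (p588458), `extC` (p591269), the pull-back `Q_k^{s*}` (its own
complexification, p588458 §3), the holomorphic averaging `iterMh` (p587371) — into ONE family and records its three properties: agreement with NODE 00's datum on real `z`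
(under the small-field guard), joint ℂ-differentiability (at every complex point whose iterated loop matrices lie in the polydisc — an open condition), and the symmetry
`datum(z̄; θV) = θ ∘ datum(z; V)` that `criticalFamily_equivariant` consumes.

CONTENTS.  §1 `differentiableAt_iterMh_of_polydisc` (the general-point edition of `B15AveragingHolomorphic.differentiableAt_iterMh`).  §2 `conjVec` (coordinatewise conjugation of a
`ℂ³`-valued bond field), ★ `cfgC` (`expMulC B′ (extC Λ lo hi (expMulC p W))`), ★ `datumC` (`Q_k^{s*} ∘ cfgC`), ★ `avgC` (`iterMh j ∘ datumC`) — DEFS; ★★ `cfgC_real` ∕ `datumC_real` ∕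
★★★ `avgC_real` (agreement with `coeField` of NODE 00's objects on real parameters); ★★ `differentiableAt_cfgC` ∕ `differentiableAt_datumC` ∕ ★★★ `differentiableAt_avgC`; ★ `cfgC_theta` ∕
`datumC_theta` ∕ ★★ `avgC_theta`.  No estimate of print; no `instance`, no `sorry`.
-/

noncomputable section

namespace Literature.MathematicalPhysics.QuantumFieldTheory.Balaban1983to89.B15ComplexifiedDatumFamily

open Literature.MathematicalPhysics.QuantumFieldTheory.Balaban1983to89.Node00 (SU avOfRecord coeField coeField_apply SmallBelow)
open B15AveragingHolomorphic (avgMh iterMh iterMh_zero iterMh_succ loopMh differentiableAt_avgMh coeField_avgFamily_eq_iterMh iterMh_theta)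
open B15SU2ChartHolomorphic (expPointC expMulC expMulC_cplxVec_coeField differentiableAt_expMulC det_expMulC expMulC_theta coeField_qsstarGIter0
  differentiable_qsstarGIter0 qsstarGIter0_map star_inv_one_eq)
open B15ExtensionHolomorphic (extC extC_coeField differentiable_extC extC_theta)
open Literature.MathematicalPhysics.QuantumFieldTheory.BalabanImbrieJaffe1984to88.BIJ85Eq453GaugeField (qsstarGIter0)
open B15Prop1AnalyticExtClause (cplxVec)
open B15Prop1ChartSU2 (su2Chart)
open B15ShellGauge193 (shellGauge)
open B15Extension193 (extend)
open B16Sect1Backgrounds (expMul)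
open T4CubeChartGnomonic (SU2)
open T4Continuum B15DeterminingSets BlockAveraging
open scoped Matrix.Norms.L2Operator

/-! ## §1  The holomorphic iterate is ℂ-differentiable at every field on the iterated polydisc -/

section Iterate

variable {P : Params} {N : ℕ}

/-- **GENERAL-POINT EDITION** of `B15AveragingHolomorphic.differentiableAt_iterMh`: `iterMh k` is ℂ-differentiable at every (complex) field `V` whose iterates `iterMh j V`, `j < k`,
have their (0.4) loop matrices in the polydisc `‖W − 1‖ < 1` (an OPEN condition — so holomorphy holds on a neighbourhood of every guarded real field).
[cite: Balaban1987RG1, (0.4) p.253 («analytic function»), (0.21) p.256; Balaban1985Variational, Prop. 9 p.309] -/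
theorem differentiableAt_iterMh_of_polydisc {V : PBond P 0 → Matrix (Fin N) (Fin N) ℂ} :
    ∀ k, (∀ j, j < k → ∀ (c : PBond P (j + 1)) (i : Idx P), ‖loopMh (iterMh j V) c i - 1‖ < 1) →
      DifferentiableAt ℂ (iterMh k : (PBond P 0 → Matrix (Fin N) (Fin N) ℂ) → PBond P k → Matrix (Fin N) (Fin N) ℂ) V
  | 0, _ => differentiableAt_id
  | k + 1, h => by
    have ih := differentiableAt_iterMh_of_polydisc k fun j hj => h j (Nat.lt_succ_of_lt hj)
    have hk : DifferentiableAt ℂ (avgMh : (PBond P k → Matrix (Fin N) (Fin N) ℂ) → PBond P (k + 1) → Matrix (Fin N) (Fin N) ℂ) (iterMh k V) :=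
      differentiableAt_avgMh (h k (Nat.lt_succ_self k))
    exact hk.comp V ih

end Iterate

/-! ## §2  The composed family `(p, B′) ↦ M˙(Q_k^{s*}(exp(iB′)·ext(exp(ip)V_k)))` -/

section Family

variable {P : Params} {k : ℕ}

/-- Coordinatewise complex conjugation of a `ℂ³`-valued bond field (the involution of the parameter space whose fixed points are the real fields `cplxVec p`).
[cite: Balaban1989LargeFieldI, Prop. 1 p.194 («B′ ∈ 𝔤ᶜ»; bookkeeping)] -/
def conjVec (B : VecField P k (EuclideanSpace ℂ (Fin 3))) : VecField P k (EuclideanSpace ℂ (Fin 3)) :=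
  fun b => WithLp.toLp 2 fun a => starRingEnd ℂ (B b a)

/-- Real fields are fixed by `conjVec`. [cite: Balaban1989LargeFieldI, Prop. 1 p.194 (bookkeeping)] -/
theorem conjVec_cplxVec (p : VecField P k (EuclideanSpace ℝ (Fin 3))) : conjVec (cplxVec p) = cplxVec p := by
  funext b; ext a
  simp [conjVec, cplxVec]

variable (Λ : Set (Site P k)) (lo hi : Fin P.d → ℤ)

/-- ★ **THE COMPLEXIFIED CONFIGURATION** `exp(iB′)·ext(exp(ip)W)` on `M₂(ℂ)`-valued level-`k` fields (`expMulC`, `extC`). [cite: Balaban1989LargeFieldI, p.193, Prop. 1 p.194] -/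
def cfgC (W : PBond P k → Matrix (Fin 2) (Fin 2) ℂ) (p B' : VecField P k (EuclideanSpace ℂ (Fin 3))) : PBond P k → Matrix (Fin 2) (Fin 2) ℂ :=
  expMulC B' (extC Λ lo hi (expMulC p W))

/-- ★ **THE COMPLEXIFIED DATUM AT LEVEL 0**: `Q_k^{s*}` of the complexified configuration. [cite: Balaban1988Convergent, (2.14) p.257; Balaban1989LargeFieldI, (1.74) p.192] -/
def datumC (W : PBond P k → Matrix (Fin 2) (Fin 2) ℂ) (p B' : VecField P k (EuclideanSpace ℂ (Fin 3))) : PBond P 0 → Matrix (Fin 2) (Fin 2) ℂ :=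
  fun b => qsstarGIter0 (G := Matrix (Fin 2) (Fin 2) ℂ) k (cfgC Λ lo hi W p B') b

/-- ★ **THE COMPLEXIFIED AVERAGED DATUM AT LEVEL `j`**: `M^j(Q_k^{s*}(·))` through the holomorphic averaging `iterMh`. [cite: Balaban1988Convergent, (2.11) p.256; Balaban1989LargeFieldI, (1.74) p.192] -/
def avgC (j : ℕ) (W : PBond P k → Matrix (Fin 2) (Fin 2) ℂ) (p B' : VecField P k (EuclideanSpace ℂ (Fin 3))) : PBond P j → Matrix (Fin 2) (Fin 2) ℂ :=
  iterMh j (datumC Λ lo hi W p B')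

/-! ### Agreement with NODE 00's objects on real parameters -/

/-- ★★ On real parameters the complexified configuration IS the matrix field of `expMul su2Chart B′ (extend Λ (shellGauge · lo hi) (expMul su2Chart p V_k))`.
[cite: Balaban1989LargeFieldI, p.193, Prop. 1 p.194] -/
theorem cfgC_real (Vk : GaugeField P k SU2) (p B' : VecField P k (EuclideanSpace ℝ (Fin 3))) :
    cfgC Λ lo hi (coeField Vk) (cplxVec p) (cplxVec B') =
      coeField (expMul su2Chart B' (extend Λ (shellGauge (expMul su2Chart p Vk) lo hi) (expMul su2Chart p Vk))) := by
  unfold cfgC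
  rw [expMulC_cplxVec_coeField, extC_coeField, expMulC_cplxVec_coeField]

/-- ★★ On real parameters the complexified datum IS the matrix field of `Q_k^{s*}` of the configuration of record. [cite: Balaban1988Convergent, (2.14) p.257] -/
theorem datumC_real (Vk : GaugeField P k SU2) (p B' : VecField P k (EuclideanSpace ℝ (Fin 3))) :
    datumC Λ lo hi (coeField Vk) (cplxVec p) (cplxVec B') =
      coeField (qsstarGIter0 k (expMul su2Chart B' (extend Λ (shellGauge (expMul su2Chart p Vk) lo hi) (expMul su2Chart p Vk)))) := by
  funext b
  unfold datumC
  rw [cfgC_real, ← coeField_qsstarGIter0]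

variable {F : T4Family}

/-- ★★★ **ON REAL PARAMETERS THE COMPLEXIFIED AVERAGED DATUM IS THE MATRIX FIELD OF NODE 00's DATUM** `avgFamily (avOfRecord F 2 Kt) (qsstarGIter0 k cfg) j`, under the small-field guard
below `j` along the averages of the real configuration. [cite: Balaban1988Convergent, (2.11)–(2.14) pp.256–257; Balaban1989LargeFieldI, (1.74) p.192] -/
theorem avgC_real {Kt k : ℕ} (Λ : Set (Site (F.P Kt) k)) (lo hi : Fin (F.P Kt).d → ℤ) (j : ℕ) (Vk : GaugeField (F.P Kt) k SU2)
    (p B' : VecField (F.P Kt) k (EuclideanSpace ℝ (Fin 3)))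
    (hguard : SmallBelow (avOfRecord F 2 Kt) j
      (qsstarGIter0 k (expMul su2Chart B' (extend Λ (shellGauge (expMul su2Chart p Vk) lo hi) (expMul su2Chart p Vk))))) :
    avgC Λ lo hi j (coeField Vk) (cplxVec p) (cplxVec B') =
      coeField (avgFamily (avOfRecord F 2 Kt)
        (qsstarGIter0 k (expMul su2Chart B' (extend Λ (shellGauge (expMul su2Chart p Vk) lo hi) (expMul su2Chart p Vk)))) j) := by
  unfold avgC
  rw [datumC_real, coeField_avgFamily_eq_iterMh hguard]

/-! ### Joint ℂ-differentiability in `(p, B′)` -/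

/-- ★★ The complexified configuration is ℂ-differentiable jointly in `(p, B′)` (at every point). [cite: Balaban1985Variational, Prop. 9 (190) p.309; Balaban1989LargeFieldI, Prop. 1 p.194] -/
theorem differentiable_cfgC (W : PBond P k → Matrix (Fin 2) (Fin 2) ℂ) :
    Differentiable ℂ (fun z : VecField P k (EuclideanSpace ℂ (Fin 3)) × VecField P k (EuclideanSpace ℂ (Fin 3)) => cfgC Λ lo hi W z.1 z.2) := by
  intro z
  unfold cfgC
  have h1 : DifferentiableAt ℂ (fun z : VecField P k (EuclideanSpace ℂ (Fin 3)) × VecField P k (EuclideanSpace ℂ (Fin 3)) => expMulC z.1 W) z :=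
    differentiableAt_expMulC differentiableAt_fst (differentiableAt_const _)
  have h2 : DifferentiableAt ℂ ((fun V : PBond P k → Matrix (Fin 2) (Fin 2) ℂ => extC Λ lo hi V) ∘
      fun z : VecField P k (EuclideanSpace ℂ (Fin 3)) × VecField P k (EuclideanSpace ℂ (Fin 3)) => expMulC z.1 W) z :=
    ((differentiable_extC Λ lo hi) _).comp z h1
  exact differentiableAt_expMulC differentiableAt_snd h2

/-- ★★ The complexified datum is ℂ-differentiable jointly in `(p, B′)`. [cite: Balaban1985Variational, Prop. 9 (190) p.309] -/
theorem differentiable_datumC (W : PBond P k → Matrix (Fin 2) (Fin 2) ℂ) :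
    Differentiable ℂ (fun z : VecField P k (EuclideanSpace ℂ (Fin 3)) × VecField P k (EuclideanSpace ℂ (Fin 3)) => datumC Λ lo hi W z.1 z.2) := by
  have h := (differentiable_qsstarGIter0 (P := P) (N := 2) k).comp (differentiable_cfgC Λ lo hi W)
  exact h

/-- ★★★ **THE COMPLEXIFIED AVERAGED DATUM IS ℂ-DIFFERENTIABLE jointly in `(p, B′)`** at every point whose iterated loop matrices lie in the polydisc (OPEN; contains a complex
neighbourhood of every guarded real point). [cite: Balaban1985Variational, Prop. 9 (190) p.309; Balaban1987RG1, (0.4) p.253 («analytic function»)] -/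
theorem differentiableAt_avgC (j : ℕ) (W : PBond P k → Matrix (Fin 2) (Fin 2) ℂ) (z₀ : VecField P k (EuclideanSpace ℂ (Fin 3)) × VecField P k (EuclideanSpace ℂ (Fin 3)))
    (hpoly : ∀ j', j' < j → ∀ (c : PBond P (j' + 1)) (i : Idx P), ‖loopMh (iterMh j' (datumC Λ lo hi W z₀.1 z₀.2)) c i - 1‖ < 1) :
    DifferentiableAt ℂ (fun z : VecField P k (EuclideanSpace ℂ (Fin 3)) × VecField P k (EuclideanSpace ℂ (Fin 3)) => avgC Λ lo hi j W z.1 z.2) z₀ := by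
  unfold avgC
  exact (differentiableAt_iterMh_of_polydisc j hpoly).comp z₀ ((differentiable_datumC Λ lo hi W) z₀)

/-! ### The symmetry: conjugation of the parameters ↔ the unitary real structure `θ` -/

/-- ★ `θ`-SYMMETRY OF THE COMPLEXIFIED CONFIGURATION: `cfgC (θ∘W) p̄ B̄′ = θ ∘ cfgC W p B′` for invertible `W`. [cite: Balaban1985Variational, p.307, Prop. 9 p.309] -/
theorem cfgC_theta (W : PBond P k → Matrix (Fin 2) (Fin 2) ℂ) (hW : ∀ b, IsUnit (W b).det) (p B' : VecField P k (EuclideanSpace ℂ (Fin 3))) :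
    cfgC Λ lo hi (fun b => (star (W b))⁻¹) (conjVec p) (conjVec B') = fun b => (star (cfgC Λ lo hi W p B' b))⁻¹ := by
  funext b
  unfold cfgC
  have h1 : expMulC (conjVec p) (fun b => (star (W b))⁻¹) = fun b => (star (expMulC p W b))⁻¹ :=
    funext fun b => (expMulC_theta p W b).symm
  have hdet : ∀ b, IsUnit (expMulC p W b).det := fun b => by rw [det_expMulC]; exact hW b
  have h2 : extC Λ lo hi (fun b => (star (expMulC p W b))⁻¹) = fun b => (star (extC Λ lo hi (expMulC p W) b))⁻¹ := extC_theta Λ lo hi hdet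
  rw [h1, h2]
  exact (expMulC_theta B' _ b).symm

/-- ★ `θ`-symmetry of the complexified datum (the pull-back commutes with `θ`, which fixes `1`). [cite: Balaban1985Variational, p.307] -/
theorem datumC_theta (W : PBond P k → Matrix (Fin 2) (Fin 2) ℂ) (hW : ∀ b, IsUnit (W b).det) (p B' : VecField P k (EuclideanSpace ℂ (Fin 3))) :
    datumC Λ lo hi (fun b => (star (W b))⁻¹) (conjVec p) (conjVec B') = fun b => (star (datumC Λ lo hi W p B' b))⁻¹ := by
  funext b
  unfold datumC
  rw [cfgC_theta Λ lo hi W hW, qsstarGIter0_map (fun A : Matrix (Fin 2) (Fin 2) ℂ => (star A)⁻¹) star_inv_one_eq]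

/-- ★★ **`θ`-SYMMETRY OF THE COMPLEXIFIED AVERAGED DATUM**: `avgC j (θ∘W) p̄ B̄′ = θ ∘ avgC j W p B′` for invertible `W`, at parameters whose datum is invertible bondwise and whose
iterated loop matrices lie in the `1∕3`-polydisc — the hypothesis `hP` of `ConstrainedCriticalFamily.criticalFamily_equivariant` for the constraint side, with σ =
(`conjVec`, `θ`). [cite: Balaban1985Variational, p.307, Prop. 9 (190) p.309] -/
theorem avgC_theta (j : ℕ) (W : PBond P k → Matrix (Fin 2) (Fin 2) ℂ) (hW : ∀ b, IsUnit (W b).det) (p B' : VecField P k (EuclideanSpace ℂ (Fin 3)))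
    (hinv : ∀ b, IsUnit (datumC Λ lo hi W p B' b).det)
    (hpoly : ∀ j', j' < j → ∀ (c : PBond P (j' + 1)) (i : Idx P), ‖loopMh (iterMh j' (datumC Λ lo hi W p B')) c i - 1‖ ≤ 1 / 3) :
    avgC Λ lo hi j (fun b => (star (W b))⁻¹) (conjVec p) (conjVec B') = fun b => (star (avgC Λ lo hi j W p B' b))⁻¹ := by
  unfold avgC
  rw [datumC_theta Λ lo hi W hW]
  exact iterMh_theta hinv j hpoly

end Family

end Literature.MathematicalPhysics.QuantumFieldTheory.Balaban1983to89.B15ComplexifiedDatumFamily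

end
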